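import Summits.AtomisticToContinuum.HydrodynamicLimit.Theorems.ImplosionDichotomyPolynomialCompressionFrozenEnergyIdentity
import Summits.AtomisticToContinuum.HydrodynamicLimit.Theorems.ImplosionDichotomyPolynomialCompressionWeightTransport
import Summits.AtomisticToContinuum.HydrodynamicLimit.Theorems.ImplosionDichotomyPolynomialCompressionDifferenceSystem
import Summits.AtomisticToContinuum.HydrodynamicLimit.Theorems.ImplosionDichotomyPolynomialCompressionQuadraticPointwise
import Summits.AtomisticToContinuum.HydrodynamicLimit.Theorems.ImplosionDichotomyPolynomialCompressionPairingPointwise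
import Summits.AtomisticToContinuum.HydrodynamicLimit.Theorems.ImplosionDichotomyPolynomialCompressionIsentropicCalculus
import Summits.AtomisticToContinuum.HydrodynamicLimit.Theorems.ImplosionDichotomyPolynomialCompressionEnergyShell
import Mathlib.Analysis.SpecialFunctions.Integrals.Basic

/-!
# Level-0 (`L²`) shadowing estimate for hard-sphere solutions near the ideal-gas implosion

Helper file for the line `log-lipschitz-budget` of the crux
`ImplosionDichotomy.PolynomialCompression` (stmt-AtomisticToContinuum-12587), stub
`stub_logBudgetShadowing`, blueprint §3. Data: a classical hard-sphere solution `V = (ρ, u, θ)`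
on `[0, T) × 𝕋³` with pressure law `ρ θ ζ(ρ)` (`ζ` smooth on an open set containing the values of
`ρ`; rescaled virial bounds `|ζ(ρ) - 1|, |ρ ζ'(ρ)|, |ρ² ζ''(ρ)| ≤ c_Z ρσ³`) and an isentropic
ideal-gas reference `V₁ = (ρ₁, u₁, θ₁ = K ρ₁^{2/3})` (`σ = 0`) of Type I
(`|∂ᵢu₁|, |∂ᵢρ₁^{1/3}| ≤ C/(T₁ - t)`), `T ≤ T₁`; weak bootstrap hypotheses `|δρ| ≤ ρ₁/2`,
`|δθ| ≤ θ₁/2`, `ρσ³(c_Z + 1) ≤ 1/8`, `|∂ᵢδu|, √θ₁|∂ᵢδρ|/ρ₁, |∂ᵢδθ|/√θ₁ ≤ C_b/(T₁ - t)` on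
`δV = V - V₁`. With `e₀ = ½ (A δρ² + ρ |δu|² + B δθ²)` (`A = θ γ(ρ)/ρ`, `γ = ζ + id·ζ'`,
`B = 3ρ/(2θ)`) and constants `Λ, Γ ≥ 0` depending only on `K, C, C_b, c_Z`:

* `level0_pointwise_balance` — `∂ₜe₀ + Σᵢ ∂ᵢΦᵢ ≤ Λ/(T₁ - t) e₀ + Γσ³(1 + ρ₁^{1/3})⁸/(T₁ - t) √e₀`
  pointwise: the frozen energy identity `hsEuler_frozen_energy_identity` with `W = δV`, its
  `F`-terms rewritten by the difference system (`hsEuler_difference_*`, reference law `ζ₂ ≡ 1`),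
  its coefficients by `hsEuler_weightA/B_transport`, `hsEuler_coeffRho/Theta_partialDeriv`, the
  reference through `c₁ = ρ₁^{1/3}` (`isentropic_*`), and the two pointwise real inequalities
  `frozen_quadratic_pointwise_bound` + `level0_pairing_pointwise_bound` (`linear_combination`);
* `level0_shadowing` — for a continuous envelope `ρ₁^{1/3} ≤ P(t)`,
  `√E₀(t) ≤ (T₁/(T₁ - t))^{Λ/2} (√E₀(0) + ½ ∫₀ᵗ Γσ³(1 + P)⁸/(T₁ - s) ds)`, `E₀ = ∫ e₀`: forcing
  `r := ∂ₜe₀ + div Φ - Λ(t)e₀`, `(1 + ρ₁^{1/3})⁸ ≤ (1 + P)⁸`, Jensen `∫√e₀ ≤ √E₀` on the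
  probability space `𝕋³`, the energy shell `torus_energy_le_of_balance` with `Λ(t) = Λ/(T₁ - t)`,
  and `exp(½Λ log(T₁/(T₁ - t))) = (T₁/(T₁ - t))^{Λ/2}`.

The higher levels (`W = ∂ˣδV`) and the closing of the bootstrap are NOT here.
-/

noncomputable section

namespace Summit.AtomisticToContinuum.HydrodynamicLimit.Theorems

open Set Filter Topology MeasureTheory
open scoped ContDiff
open Literature.MathematicalPhysics.KineticTheory Literature.Analysis.FunctionSpaces

section Level0Pointwise

/-- Coordinates commute with partial derivatives along a `C¹` vector field and are dominated by the
Euclidean norm: `|∂ᵢ(vⱼ)(x) - ∂ᵢ(v'ⱼ)(x)| ≤ ‖∂ᵢv(x) - ∂ᵢv'(x)‖`. [folklore] -/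
theorem abs_partialDeriv_coord_sub_le {v v' : T3 → V3} (hv : Torus.IsContDiff 1 v)
    (hv' : Torus.IsContDiff 1 v') (i j : Fin 3) (x : T3) :
    |Torus.partialDeriv i (fun y => v y j) x - Torus.partialDeriv i (fun y => v' y j) x| ≤
      ‖Torus.partialDeriv i v x - Torus.partialDeriv i v' x‖ := by
  rw [Torus.partialDeriv_apply_coord hv, Torus.partialDeriv_apply_coord hv', ← PiLp.sub_apply,
    ← Real.norm_eq_abs]
  exact PiLp.norm_apply_le _ j

/-- **Level-0 pointwise balance** (blueprint §3): under the hypotheses of the module docstring,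
`∂ₜe₀ + Σᵢ ∂ᵢΦᵢ ≤ Λ/(T₁ - t) · e₀ + Γ σ³ (1 + ρ₁^{1/3})⁸/(T₁ - t) · √e₀` pointwise on
`[0, T) × 𝕋³`, with `Λ, Γ ≥ 0` depending only on `K, C, C_b, c_Z` (assembly of the frozen energy
identity, the difference system, the weight transports and the two pointwise real lemmas).
[folklore] -/
theorem level0_pointwise_balance :
    ∀ (K C Cb cZ : ℝ), 0 < K → 0 ≤ C → 0 ≤ Cb → 0 ≤ cZ →
      ∃ Λ Γ : ℝ, 0 ≤ Λ ∧ 0 ≤ Γ ∧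
        ∀ {σ T T₁ : ℝ} {ρ θ ρ₁ θ₁ : ℝ → T3 → ℝ} {u u₁ : ℝ → T3 → V3} {ζ : ℝ → ℝ} {J : Set ℝ},
          IsHardSphereEulerSolution σ T ρ u θ → IsHardSphereEulerSolution 0 T ρ₁ u₁ θ₁ →
          0 < σ → T ≤ T₁ →
          IsOpen J → ContDiffOn ℝ (⊤ : ℕ∞) ζ J → (∀ t ∈ Ico 0 T, ∀ x, ρ t x ∈ J) →
          (∀ t ∈ Ico 0 T, ∀ x, hsPressure σ (ρ t x) (θ t x) = ρ t x * θ t x * ζ (ρ t x)) →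
          (∀ t ∈ Ico 0 T, ∀ x, |ζ (ρ t x) - 1| ≤ cZ * (ρ t x * σ ^ 3) ∧
            |ρ t x * deriv ζ (ρ t x)| ≤ cZ * (ρ t x * σ ^ 3) ∧
            |ρ t x ^ 2 * deriv (deriv ζ) (ρ t x)| ≤ cZ * (ρ t x * σ ^ 3)) →
          (∀ t ∈ Ico 0 T, ∀ x, θ₁ t x = K * ρ₁ t x ^ (2 / 3 : ℝ)) →
          (∀ t ∈ Ico 0 T, ∀ x, ∀ i : Fin 3,
            ‖Torus.partialDeriv i (u₁ t) x‖ ≤ C / (T₁ - t) ∧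
            |Torus.partialDeriv i (fun y => ρ₁ t y ^ (1 / 3 : ℝ)) x| ≤ C / (T₁ - t)) →
          (∀ t ∈ Ico 0 T, ∀ x, |ρ t x - ρ₁ t x| ≤ ρ₁ t x / 2 ∧ |θ t x - θ₁ t x| ≤ θ₁ t x / 2 ∧
            ρ t x * σ ^ 3 * (cZ + 1) ≤ 1 / 8) →
          (∀ t ∈ Ico 0 T, ∀ x, ∀ i : Fin 3,
            ‖Torus.partialDeriv i (u t) x - Torus.partialDeriv i (u₁ t) x‖ ≤ Cb / (T₁ - t) ∧
            Real.sqrt (θ₁ t x) *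
                |Torus.partialDeriv i (ρ t) x - Torus.partialDeriv i (ρ₁ t) x| / ρ₁ t x ≤
              Cb / (T₁ - t) ∧
            |Torus.partialDeriv i (θ t) x - Torus.partialDeriv i (θ₁ t) x| / Real.sqrt (θ₁ t x) ≤
              Cb / (T₁ - t)) →
          ∀ {t : ℝ}, t ∈ Ico 0 T → ∀ x : T3,
            Torus.timeDerivWithin (Ico 0 T) (fun s y => 1 / 2 *
                (θ s y * (ζ (ρ s y) + ρ s y * deriv ζ (ρ s y)) / ρ s y * (ρ s y - ρ₁ s y) ^ 2 +
                ρ s y * ‖u s y - u₁ s y‖ ^ 2 + 3 / 2 * ρ s y / θ s y * (θ s y - θ₁ s y) ^ 2)) t x +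
              ∑ i, Torus.partialDeriv i (fun y =>
                1 / 2 * (θ t y * (ζ (ρ t y) + ρ t y * deriv ζ (ρ t y)) / ρ t y * u t y i *
                      (ρ t y - ρ₁ t y) ^ 2 +
                    ρ t y * u t y i * ‖u t y - u₁ t y‖ ^ 2 +
                    3 / 2 * ρ t y / θ t y * u t y i * (θ t y - θ₁ t y) ^ 2) +
                  θ t y * (ζ (ρ t y) + ρ t y * deriv ζ (ρ t y)) * (ρ t y - ρ₁ t y) *
                    (u t y i - u₁ t y i) +
                  ρ t y * ζ (ρ t y) * (θ t y - θ₁ t y) * (u t y i - u₁ t y i)) x ≤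
            Λ / (T₁ - t) * (1 / 2 *
                (θ t x * (ζ (ρ t x) + ρ t x * deriv ζ (ρ t x)) / ρ t x * (ρ t x - ρ₁ t x) ^ 2 +
                  ρ t x * ‖u t x - u₁ t x‖ ^ 2 + 3 / 2 * ρ t x / θ t x * (θ t x - θ₁ t x) ^ 2)) +
              Γ * σ ^ 3 * (1 + ρ₁ t x ^ (1 / 3 : ℝ)) ^ 8 / (T₁ - t) *
                Real.sqrt (1 / 2 *
                  (θ t x * (ζ (ρ t x) + ρ t x * deriv ζ (ρ t x)) / ρ t x * (ρ t x - ρ₁ t x) ^ 2 +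
                  ρ t x * ‖u t x - u₁ t x‖ ^ 2 + 3 / 2 * ρ t x / θ t x * (θ t x - θ₁ t x) ^ 2)) := by
  intro K C Cb cZ hK hC hCb hcZ
  obtain ⟨Λ₁, hΛ₁, H⟩ := frozen_quadratic_pointwise_bound K C Cb cZ hK hC hCb hcZ
  obtain ⟨Λ₂, Γ, hΛ₂, hΓ, P⟩ := level0_pairing_pointwise_bound K C cZ hK hC hcZ
  refine ⟨Λ₁ + Λ₂, Γ, add_nonneg hΛ₁ hΛ₂, hΓ, ?_⟩
  intro σ T T₁ ρ θ ρ₁ θ₁ u u₁ ζ J hE hE₁ hσ hTT₁ hJ hζ hρJ hp hEos hIsen hTI hB0 hB1 t ht x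
  have hlam : 0 < T₁ - t := sub_pos.2 (ht.2.trans_le hTT₁)
  have hρ0 : 0 < ρ t x := hE.density_pos t ht x
  have hρ₁0 : 0 < ρ₁ t x := hE₁.density_pos t ht x
  have hu1 : Torus.IsContDiff 1 (u t) := (hE.smooth_velocity.isSmooth_slice ht).isContDiff (by simp)
  have hu₁1 : Torus.IsContDiff 1 (u₁ t) :=
    (hE₁.smooth_velocity.isSmooth_slice ht).isContDiff (by simp)
  -- the ideal-gas law of the reference in the `ρ θ ζ₂(ρ)` shape, `ζ₂ ≡ 1`
  have hp₁ : ∀ s ∈ Ico 0 T, ∀ y, hsPressure 0 (ρ₁ s y) (θ₁ s y) =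
      ρ₁ s y * θ₁ s y * (fun _ : ℝ => (1 : ℝ)) (ρ₁ s y) := fun s _ y => hsPressure_zero_eq_ideal _ _
  -- (1) the frozen identity with `W = δV`
  have hF := hsEuler_frozen_energy_identity hE hJ hζ hρJ
    (hE.smooth_density.sub hE₁.smooth_density) (hE.smooth_velocity.sub hE₁.smooth_velocity)
    (hE.smooth_temperature.sub hE₁.smooth_temperature) ht x
  simp only [PiLp.sub_apply] at hF
  rw [hF]
  -- (2)-(3) the coefficient groups and the difference system
  rw [hsEuler_weightA_transport hE hJ hζ hρJ hp ht x,
    hsEuler_weightB_transport hE hJ hζ hρJ hp ht x,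
    hsEuler_difference_density hE hE₁ ht x,
    hsEuler_difference_temperature hE hE₁ hJ hζ hρJ hp isOpen_univ contDiffOn_const
      (fun _ _ _ => mem_univ _) hp₁ ht x]
  simp only [hsEuler_coeffRho_partialDeriv hE hJ hζ hρJ ht x,
    hsEuler_coeffTheta_partialDeriv hE hJ hζ hρJ ht x,
    hsEuler_difference_velocity hE hE₁ hJ hζ hρJ hp isOpen_univ contDiffOn_const
      (fun _ _ _ => mem_univ _) hp₁ ht x,
    deriv_const, mul_zero, add_zero]
  -- (4) the isentropic reference through `c₁ = ρ₁^{1/3}`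
  obtain ⟨hc₁, hρ₁c, hθ₁c, hsq⟩ := isentropic_pointwise_algebra hK hρ₁0 (hIsen t ht x)
  have hdρ₁ := isentropic_partialDeriv_density hE₁ ht x
  have hdθ₁ := isentropic_partialDeriv_temperature hE₁ hK hIsen ht x
  generalize hc₁def : ρ₁ t x ^ (1 / 3 : ℝ) = c₁ at hc₁ hρ₁c hθ₁c hsq hdρ₁ hdθ₁ ⊢
  simp only [hdρ₁, hdθ₁]
  rw [hρ₁c, hθ₁c]
  -- the hypotheses of the two pointwise lemmas
  obtain ⟨hB0a, hB0b, hB0c⟩ := hB0 t ht x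
  rw [hρ₁c] at hB0a; rw [hθ₁c] at hB0b
  obtain ⟨hE1, hE2, hE3⟩ := hEos t ht x
  have hdu₁ : ∀ i j, |Torus.partialDeriv i (fun y => u₁ t y j) x| ≤ C / (T₁ - t) := fun i j => by
    rw [Torus.partialDeriv_apply_coord hu₁1, ← Real.norm_eq_abs]
    exact (PiLp.norm_apply_le _ j).trans (hTI t ht x i).1
  have hdu : ∀ i j, |Torus.partialDeriv i (fun y => u t y j) x -
      Torus.partialDeriv i (fun y => u₁ t y j) x| ≤ Cb / (T₁ - t) :=
    fun i j => (abs_partialDeriv_coord_sub_le hu1 hu₁1 i j x).trans (hB1 t ht x i).1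
  have hdc₁ : ∀ i, |Torus.partialDeriv i (fun y => ρ₁ t y ^ (1 / 3 : ℝ)) x| ≤ C / (T₁ - t) :=
    fun i => (hTI t ht x i).2
  have hdρ : ∀ i, Real.sqrt K * c₁ * |Torus.partialDeriv i (ρ t) x -
      3 * c₁ ^ 2 * Torus.partialDeriv i (fun y => ρ₁ t y ^ (1 / 3 : ℝ)) x| / c₁ ^ 3 ≤
      Cb / (T₁ - t) := by
    intro i; have h := (hB1 t ht x i).2.1; rwa [hsq, hdρ₁ i, hρ₁c] at h
  have hdθ : ∀ i, |Torus.partialDeriv i (θ t) x -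
      2 * K * c₁ * Torus.partialDeriv i (fun y => ρ₁ t y ^ (1 / 3 : ℝ)) x| / (Real.sqrt K * c₁) ≤
      Cb / (T₁ - t) := by
    intro i; have h := (hB1 t ht x i).2.2; rwa [hsq, hdθ₁ i] at h
  have hH := H (T₁ - t) c₁ (ρ t x) (θ t x) (ζ (ρ t x)) (ρ t x * deriv ζ (ρ t x))
    (ρ t x ^ 2 * deriv (deriv ζ) (ρ t x)) (ρ t x * σ ^ 3)
    (fun i j => Torus.partialDeriv i (fun y => u t y j) x)
    (fun i j => Torus.partialDeriv i (fun y => u₁ t y j) x)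
    (fun i => Torus.partialDeriv i (fun y => ρ₁ t y ^ (1 / 3 : ℝ)) x)
    (fun i => Torus.partialDeriv i (ρ t) x) (fun i => Torus.partialDeriv i (θ t) x)
    (ρ t x - c₁ ^ 3) (θ t x - K * c₁ ^ 2) (fun i => u t x i - u₁ t x i)
    hlam hc₁ (by positivity) hB0c hE1 hE2 hE3 hB0a hB0b hdu₁ hdu hdc₁ hdρ hdθ
  have hP := P (T₁ - t) c₁ (ρ t x) (θ t x) (ζ (ρ t x)) (ρ t x * deriv ζ (ρ t x)) (σ ^ 3)
    (fun i j => Torus.partialDeriv i (fun y => u₁ t y j) x)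
    (fun i => Torus.partialDeriv i (fun y => ρ₁ t y ^ (1 / 3 : ℝ)) x)
    (ρ t x - c₁ ^ 3) (θ t x - K * c₁ ^ 2) (fun i => u t x i - u₁ t x i)
    hlam hc₁ (by positivity) hB0c hE1 hE2 rfl rfl hB0a hB0b hdu₁ hdc₁
  beta_reduce at hH hP
  have e1 : θ t x * (2 * (ρ t x * deriv ζ (ρ t x)) + ρ t x ^ 2 * deriv (deriv ζ) (ρ t x)) / ρ t x =
      θ t x * (2 * deriv ζ (ρ t x) + ρ t x * deriv (deriv ζ) (ρ t x)) := by
    rw [div_eq_iff hρ0.ne']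
    ring
  rw [e1] at hH
  have hnorm : ‖u t x - u₁ t x‖ ^ 2 =
      (u t x 0 - u₁ t x 0) ^ 2 + (u t x 1 - u₁ t x 1) ^ 2 + (u t x 2 - u₁ t x 2) ^ 2 := by
    simp only [EuclideanSpace.norm_sq_eq, Fin.sum_univ_three, Real.norm_eq_abs, sq_abs,
      PiLp.sub_apply]
  simp only [Fin.sum_univ_three] at hH hP ⊢
  rw [hnorm]
  linear_combination hH + hP

end Level0Pointwise

section Level0Shadowing

/-- Jensen's inequality for the square root on the probability space `𝕋³`: `∫ √g ≤ √(∫ g)` for a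
continuous `g ≥ 0` (from `0 ≤ ∫ (√g - ∫√g)²`). [folklore] -/
theorem integral_sqrt_le_sqrt_integral {g : T3 → ℝ} (hg : Continuous g) (hg0 : ∀ x, 0 ≤ g x) :
    ∫ x, Real.sqrt (g x) ≤ Real.sqrt (∫ x, g x) := by
  set m : ℝ := ∫ x, Real.sqrt (g x) with hm
  have hi1 : Integrable (fun x => Real.sqrt (g x)) volume := hg.sqrt.integrable_unitAddTorus
  have hi0 : Integrable g volume := hg.integrable_unitAddTorus
  have hm0 : 0 ≤ m := integral_nonneg fun x => Real.sqrt_nonneg _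
  have hvar : 0 ≤ ∫ x, (Real.sqrt (g x) - m) ^ 2 := integral_nonneg fun x => sq_nonneg _
  have hexp : ∫ x, (Real.sqrt (g x) - m) ^ 2 = (∫ x, g x) - m ^ 2 := by
    have h : (fun x => (Real.sqrt (g x) - m) ^ 2) =
        fun x => g x - 2 * m * Real.sqrt (g x) + m ^ 2 := by
      funext x; rw [sub_sq, Real.sq_sqrt (hg0 x)]; ring
    have i3 : Integrable (fun x => 2 * m * Real.sqrt (g x)) volume := hi1.const_mul _
    have i2 : Integrable (fun x => g x - 2 * m * Real.sqrt (g x)) volume := hi0.sub i3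
    rw [h, integral_add i2 (integrable_const _), integral_sub hi0 i3, integral_const_mul,
      integral_const, ← hm, probReal_univ, one_smul]
    ring
  have h2 : m ^ 2 ≤ ∫ x, g x := by linarith
  calc m = |m| := (abs_of_nonneg hm0).symm
    _ ≤ Real.sqrt (∫ x, g x) := Real.abs_le_sqrt h2

/-- **Level-0 (`L²`) shadowing estimate** (blueprint §3, (3.1)): under the hypotheses of the
module docstring and `ρ₁^{1/3} ≤ P` (continuous), the relative energy `E₀ = ∫ e₀` obeys
`√E₀(t) ≤ (T₁/(T₁ - t))^{Λ/2} (√E₀(0) + ½ ∫₀ᵗ Γ σ³ (1 + P)⁸/(T₁ - s) ds)` on `[0, T)`, with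
`Λ, Γ ≥ 0` depending only on `K, C, C_b, c_Z` (pointwise balance, Jensen, energy shell).
[folklore] -/
theorem level0_shadowing :
    ∀ (K C Cb cZ : ℝ), 0 < K → 0 ≤ C → 0 ≤ Cb → 0 ≤ cZ →
      ∃ Λ Γ : ℝ, 0 ≤ Λ ∧ 0 ≤ Γ ∧
        ∀ {σ T T₁ : ℝ} {ρ θ ρ₁ θ₁ : ℝ → T3 → ℝ} {u u₁ : ℝ → T3 → V3} {ζ : ℝ → ℝ} {J : Set ℝ}
          {P : ℝ → ℝ},
          IsHardSphereEulerSolution σ T ρ u θ → IsHardSphereEulerSolution 0 T ρ₁ u₁ θ₁ →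
          0 < σ → 0 < T → T ≤ T₁ →
          IsOpen J → ContDiffOn ℝ (⊤ : ℕ∞) ζ J → (∀ t ∈ Ico 0 T, ∀ x, ρ t x ∈ J) →
          (∀ t ∈ Ico 0 T, ∀ x, hsPressure σ (ρ t x) (θ t x) = ρ t x * θ t x * ζ (ρ t x)) →
          (∀ t ∈ Ico 0 T, ∀ x, |ζ (ρ t x) - 1| ≤ cZ * (ρ t x * σ ^ 3) ∧
            |ρ t x * deriv ζ (ρ t x)| ≤ cZ * (ρ t x * σ ^ 3) ∧
            |ρ t x ^ 2 * deriv (deriv ζ) (ρ t x)| ≤ cZ * (ρ t x * σ ^ 3)) →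
          (∀ t ∈ Ico 0 T, ∀ x, θ₁ t x = K * ρ₁ t x ^ (2 / 3 : ℝ)) →
          (∀ t ∈ Ico 0 T, ∀ x, ∀ i : Fin 3,
            ‖Torus.partialDeriv i (u₁ t) x‖ ≤ C / (T₁ - t) ∧
            |Torus.partialDeriv i (fun y => ρ₁ t y ^ (1 / 3 : ℝ)) x| ≤ C / (T₁ - t)) →
          ContinuousOn P (Ico 0 T) → (∀ t ∈ Ico 0 T, ∀ x, ρ₁ t x ^ (1 / 3 : ℝ) ≤ P t) →
          (∀ t ∈ Ico 0 T, ∀ x, |ρ t x - ρ₁ t x| ≤ ρ₁ t x / 2 ∧ |θ t x - θ₁ t x| ≤ θ₁ t x / 2 ∧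
            ρ t x * σ ^ 3 * (cZ + 1) ≤ 1 / 8) →
          (∀ t ∈ Ico 0 T, ∀ x, ∀ i : Fin 3,
            ‖Torus.partialDeriv i (u t) x - Torus.partialDeriv i (u₁ t) x‖ ≤ Cb / (T₁ - t) ∧
            Real.sqrt (θ₁ t x) *
                |Torus.partialDeriv i (ρ t) x - Torus.partialDeriv i (ρ₁ t) x| / ρ₁ t x ≤
              Cb / (T₁ - t) ∧
            |Torus.partialDeriv i (θ t) x - Torus.partialDeriv i (θ₁ t) x| / Real.sqrt (θ₁ t x) ≤
              Cb / (T₁ - t)) →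
          ∀ t ∈ Ico 0 T,
            Real.sqrt (∫ x, 1 / 2 *
                (θ t x * (ζ (ρ t x) + ρ t x * deriv ζ (ρ t x)) / ρ t x * (ρ t x - ρ₁ t x) ^ 2 +
                  ρ t x * ‖u t x - u₁ t x‖ ^ 2 + 3 / 2 * ρ t x / θ t x * (θ t x - θ₁ t x) ^ 2)) ≤
              (T₁ / (T₁ - t)) ^ (Λ / 2) *
                (Real.sqrt (∫ x, 1 / 2 *
                    (θ 0 x * (ζ (ρ 0 x) + ρ 0 x * deriv ζ (ρ 0 x)) / ρ 0 x * (ρ 0 x - ρ₁ 0 x) ^ 2 +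
                      ρ 0 x * ‖u 0 x - u₁ 0 x‖ ^ 2 +
                      3 / 2 * ρ 0 x / θ 0 x * (θ 0 x - θ₁ 0 x) ^ 2)) +
                  (∫ s in (0 : ℝ)..t, Γ * σ ^ 3 * (1 + P s) ^ 8 / (T₁ - s)) / 2) := by
  intro K C Cb cZ hK hC hCb hcZ
  obtain ⟨Λ, Γ, hΛ, hΓ, hpt⟩ := level0_pointwise_balance K C Cb cZ hK hC hCb hcZ
  refine ⟨Λ, Γ, hΛ, hΓ, ?_⟩
  intro σ T T₁ ρ θ ρ₁ θ₁ u u₁ ζ J P hE hE₁ hσ hT hTT₁ hJ hζ hρJ hp hEos hIsen hTI hPc hPle hB0 hB1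
    t ht
  have hU : UniqueDiffOn ℝ (Ico (0 : ℝ) T) := uniqueDiffOn_Ico 0 T
  have hT₁ : ∀ s ∈ Ico 0 T, 0 < T₁ - s := fun s hs => sub_pos.2 (hs.2.trans_le hTT₁)
  -- smooth building blocks
  have hA := isSmoothSpaceTimeOn_weightA hE hJ hζ hρJ
  have hB := isSmoothSpaceTimeOn_weightB hE
  have hζρ := isSmoothSpaceTimeOn_comp_density hE.smooth_density hζ hρJ
  have hζ'ρ := isSmoothSpaceTimeOn_comp_density hE.smooth_density
    (hζ.deriv_of_isOpen hJ le_rfl) hρJ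
  have hα := hE.smooth_density.sub hE₁.smooth_density
  have hw := hE.smooth_velocity.sub hE₁.smooth_velocity
  have hβ := hE.smooth_temperature.sub hE₁.smooth_temperature
  -- the energy density, the fluxes, the coefficient, the forcing bound, the forcing density
  set e : ℝ → T3 → ℝ := fun s y => 1 / 2 *
    (θ s y * (ζ (ρ s y) + ρ s y * deriv ζ (ρ s y)) / ρ s y * (ρ s y - ρ₁ s y) ^ 2 +
      ρ s y * ‖u s y - u₁ s y‖ ^ 2 + 3 / 2 * ρ s y / θ s y * (θ s y - θ₁ s y) ^ 2) with he_def
  set Φ : Fin 3 → ℝ → T3 → ℝ := fun i s y =>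
    1 / 2 * (θ s y * (ζ (ρ s y) + ρ s y * deriv ζ (ρ s y)) / ρ s y * u s y i *
          (ρ s y - ρ₁ s y) ^ 2 +
        ρ s y * u s y i * ‖u s y - u₁ s y‖ ^ 2 +
        3 / 2 * ρ s y / θ s y * u s y i * (θ s y - θ₁ s y) ^ 2) +
      θ s y * (ζ (ρ s y) + ρ s y * deriv ζ (ρ s y)) * (ρ s y - ρ₁ s y) * (u s y i - u₁ s y i) +
      ρ s y * ζ (ρ s y) * (θ s y - θ₁ s y) * (u s y i - u₁ s y i) with hΦ_def
  set Lf : ℝ → ℝ := fun s => Λ / (T₁ - s) with hLf_def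
  set G : ℝ → ℝ := fun s => Γ * σ ^ 3 * (1 + P s) ^ 8 / (T₁ - s) with hG_def
  set r : ℝ → T3 → ℝ := fun s y => Torus.timeDerivWithin (Ico 0 T) e s y +
    ∑ i, Torus.partialDeriv i (Φ i s) y - Lf s * e s y with hr_def
  -- joint smoothness
  have he : Torus.IsSmoothSpaceTimeOn (Ico 0 T) e := by
    have h := ((hA.mul (hα.mul hα)).add (hE.smooth_density.mul (hw.inner hw))).add
      (hB.mul (hβ.mul hβ))
    refine ContDiffOn.congr (h.const_smul (1 / 2 : ℝ)) ?_
    rintro ⟨s, y⟩ _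
    simp only [Torus.stLift_apply, he_def, smul_eq_mul, real_inner_self_eq_norm_sq]
    ring
  have hΦ : ∀ i, Torus.IsSmoothSpaceTimeOn (Ico 0 T) (Φ i) := by
    intro i
    have hui := hE.smooth_velocity.apply i
    have hwi := hw.apply i
    have hγ := hζρ.add (hE.smooth_density.mul hζ'ρ)
    have h := (((((hA.mul hui).mul (hα.mul hα)).add
      ((hE.smooth_density.mul hui).mul (hw.inner hw))).add
      ((hB.mul hui).mul (hβ.mul hβ))).const_smul (1 / 2 : ℝ)).add
      ((((hE.smooth_temperature.mul hγ).mul hα).mul hwi).add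
        (((hE.smooth_density.mul hζρ).mul hβ).mul hwi))
    refine ContDiffOn.congr h ?_
    rintro ⟨s, y⟩ _
    simp only [Torus.stLift_apply, hΦ_def, smul_eq_mul, real_inner_self_eq_norm_sq,
      PiLp.sub_apply]
    ring
  have hLfield : Torus.IsSmoothSpaceTimeOn (Ico 0 T) (fun s (_ : T3) => Lf s) := by
    have h : ContDiffOn ℝ ∞ (fun p : ℝ × EuclideanSpace ℝ (Fin 3) => Λ / (T₁ - p.1))
        (Ico 0 T ×ˢ univ) := ContDiffOn.div contDiffOn_const (contDiffOn_const.sub contDiffOn_fst)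
      fun p hq => (hT₁ p.1 (mem_prod.1 hq).1).ne'
    exact h
  have hr : Torus.IsSmoothSpaceTimeOn (Ico 0 T) r :=
    ((he.timeDerivWithin hU).add (Torus.IsSmoothSpaceTimeOn.sum (s := Finset.univ) fun i _ =>
      (hΦ i).partialDeriv hU i)).sub (hLfield.mul he)
  -- positivity of the energy density (`γ = ζ + ρζ' ≥ 3/4`)
  have he0 : ∀ s ∈ Ico 0 T, ∀ y, 0 ≤ e s y := by
    intro s hs y
    have hρ0 := hE.density_pos s hs y; have hθ0 := hE.temperature_pos s hs y
    have hγ : 0 < ζ (ρ s y) + ρ s y * deriv ζ (ρ s y) := by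
      obtain ⟨h1, h2, -⟩ := hEos s hs y
      obtain ⟨-, -, h3⟩ := hB0 s hs y
      have hη : 0 ≤ ρ s y * σ ^ 3 := by positivity
      have h4 : cZ * (ρ s y * σ ^ 3) ≤ 1 / 8 := by nlinarith
      rw [abs_le] at h1 h2
      linarith [h1.1, h2.1]
    simp only [he_def]
    positivity
  -- the scalar data of the shell
  have hLc : ContinuousOn Lf (Ico 0 T) :=
    continuousOn_const.div (continuousOn_const.sub continuousOn_id) fun s hs => (hT₁ s hs).ne'
  have hGc : ContinuousOn G (Ico 0 T) :=
    (continuousOn_const.mul ((continuousOn_const.add hPc).pow 8)).div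
      (continuousOn_const.sub continuousOn_id) fun s hs => (hT₁ s hs).ne'
  have hL0 : ∀ s ∈ Ico 0 T, 0 ≤ Lf s := fun s hs => div_nonneg hΛ (hT₁ s hs).le
  have hG0 : ∀ s ∈ Ico 0 T, 0 ≤ G s := fun s hs =>
    div_nonneg (mul_nonneg (by positivity) (Even.pow_nonneg (by decide) _)) (hT₁ s hs).le
  have hbal : ∀ s ∈ Ico 0 T, ∀ y, Torus.timeDerivWithin (Ico 0 T) e s y +
      ∑ i, Torus.partialDeriv i (Φ i s) y ≤ Lf s * e s y + r s y := by
    intro s hs y; simp only [hr_def]; linarith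
  -- the forcing bound: pointwise balance, `(1 + ρ₁^{1/3})⁸ ≤ (1 + P)⁸`, Jensen
  have hrG : ∀ s ∈ Ico 0 T, ∫ y, r s y ≤ G s * Real.sqrt (∫ y, e s y) := by
    intro s hs
    have hes : Torus.IsSmooth (e s) := he.isSmooth_slice hs
    have hTs := hT₁ s hs
    have hptw : ∀ y, r s y ≤ G s * Real.sqrt (e s y) := by
      intro y
      have hρ₁0 := hE₁.density_pos s hs y
      have h1 : Torus.timeDerivWithin (Ico 0 T) e s y + ∑ i, Torus.partialDeriv i (Φ i s) y ≤
          Λ / (T₁ - s) * e s y +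
            Γ * σ ^ 3 * (1 + ρ₁ s y ^ (1 / 3 : ℝ)) ^ 8 / (T₁ - s) * Real.sqrt (e s y) :=
        hpt hE hE₁ hσ hTT₁ hJ hζ hρJ hp hEos hIsen hTI hB0 hB1 hs y
      have h2 : Γ * σ ^ 3 * (1 + ρ₁ s y ^ (1 / 3 : ℝ)) ^ 8 / (T₁ - s) * Real.sqrt (e s y) ≤
          G s * Real.sqrt (e s y) :=
        mul_le_mul_of_nonneg_right (div_le_div_of_nonneg_right (mul_le_mul_of_nonneg_left
          (pow_le_pow_left₀ (by positivity) (by linarith [hPle s hs y]) 8) (by positivity)) hTs.le)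
          (Real.sqrt_nonneg _)
      simp only [hr_def, hLf_def]
      linarith
    calc ∫ y, r s y ≤ ∫ y, G s * Real.sqrt (e s y) :=
          integral_mono (hr.isSmooth_slice hs).integrable
            (hes.continuous.sqrt.integrable_unitAddTorus.const_mul _) hptw
      _ = G s * ∫ y, Real.sqrt (e s y) := integral_const_mul _ _
      _ ≤ G s * Real.sqrt (∫ y, e s y) :=
          mul_le_mul_of_nonneg_left (integral_sqrt_le_sqrt_integral hes.continuous (he0 s hs))
            (hG0 s hs)
  -- the shell, and `exp(½ ∫₀ᵗ Λ/(T₁ - s) ds) = (T₁/(T₁ - t))^{Λ/2}`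
  have key := torus_energy_le_of_balance he hr hΦ he0 hLc hGc hL0 hG0 hbal hrG t ht
  have hT₁0 : 0 < T₁ := hT.trans_le hTT₁
  have hT₁t : 0 < T₁ - t := hT₁ t ht
  have hexp : Real.exp ((∫ s in (0:ℝ)..t, Lf s) / 2) = (T₁ / (T₁ - t)) ^ (Λ / 2) := by
    have hint : ∫ s in (0:ℝ)..t, Lf s = Λ * Real.log (T₁ / (T₁ - t)) := by
      have h1 : ∫ s in (0:ℝ)..t, Lf s = Λ * ∫ s in (0:ℝ)..t, (fun v : ℝ => v⁻¹) (T₁ - s) := by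
        rw [← intervalIntegral.integral_const_mul]
        simp only [hLf_def, div_eq_mul_inv]
      rw [h1, intervalIntegral.integral_comp_sub_left (fun v : ℝ => v⁻¹) T₁, sub_zero,
        integral_inv_of_pos hT₁t hT₁0]
    rw [hint, Real.rpow_def_of_pos (div_pos hT₁0 hT₁t)]
    congr 1; ring
  rwa [hexp] at key

end Level0Shadowing

end Summit.AtomisticToContinuum.HydrodynamicLimit.Theorems

end
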